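import Literature.Probability.LatticeModels.LatticeDirichletBoundaryRegularity
import Literature.Probability.LatticeModels.LatticeTaylorConsistency
import Literature.Probability.LatticeModels.LatticePoissonStability
import HarnessLib

/-!
# Convergence of lattice-harmonic functions with convergent boundary data, uniformly

Topic `Literature/Probability/LatticeModels` (discrete potential theory on `δℤ²`; the
consistency-and-stability proof that discrete harmonic functions on the discretisations of a
planar domain converge to the continuum harmonic function with the same boundary values, on the
discharge path of `Kenyon2000_flatEdgePoissonKernelLimit` — Kenyon 2000, Lemma 17: "since `g` is
smooth … its discrete Laplacian is `O(ε⁴)` … by the maximum principle … `|H - H₀ - g| = O(ε)`",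
here with the boundary layer handled by `abs_sub_le_near_frontier`).

Setting as in `LatticeDirichletBoundaryRegularity.lean` (`Ω` open bounded with the uniform
exterior quadrant condition, meshes `δₙ → 0`, `Sₙ = {v | δₙ v ∈ closure Ω}`, `Fₙ` lattice
harmonic on `Sₙ` with outer boundary values `Φ ∘ δₙ + o(1)`, `f` continuous on `closure Ω`, equal
to `Φ` on the frontier) and moreover `f` **harmonic** on `Ω`. **Theorem**
(`abs_sub_le_of_harmonicOnNhd`): `sup_{v ∈ Sₙ} |Fₙ v - f(δₙ v)| → 0`. Proof: near the frontier
by `abs_sub_le_near_frontier`; on `K = {z ∈ closure Ω | infDist z ∂Ω ≥ ρ/2}` (compact, inside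
`Ω`) the error `e = Fₙ - f ∘ δₙ` has `|Δ e| ≤ C δₙ⁴` (`LatticeTaylorConsistency`) and is small on
the outer boundary of `{v | δₙ v ∈ K}`, hence small inside by the stability estimate
`abs_le_of_abs_latticeLaplacian_le` (`LatticePoissonStability`), the box having radius
`O(1/δₙ)`.

Everything is proved, [folklore]; no named fact.

## References

* R. Kenyon, *Conformal invariance of domino tiling*, Ann. Probab. 28 (2000), Lemma 17
  [Kenyon2000].
* R. Courant, K. Friedrichs, H. Lewy, Math. Ann. 100 (1928), §2 [folklore].
-/

noncomputable section

namespace Literature.Probability.LatticeModels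

open Set Metric Filter Complex _root_.Topology WeakBeurling Literature.Probability.Percolation

/-- Adjacent sites have mesh points at distance exactly the mesh. [folklore] -/
private theorem dist_meshPoint_add_cornerUnit_of_nonneg {δ : ℝ} (hδ : 0 ≤ δ) (v : Site 2) (k : Fin 4) :
    dist (meshPoint δ v) (meshPoint δ (v + cornerUnit k)) = δ := by
  have hsq : dist (meshPoint δ v) (meshPoint δ (v + cornerUnit k)) ^ 2 = δ ^ 2 := by
    rw [dist_meshPoint_sq, meshPoint_re, meshPoint_im]
    rcases coord_step_of_stepKind (stepKind_add_cornerUnit v k) with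
      ⟨h0, h1⟩ | ⟨h0, h1⟩ | ⟨h0, h1⟩ | ⟨h0, h1⟩
    · rw [h0, h1]; push_cast; ring
    · rw [h0, h1]; push_cast; ring
    · rw [h0, h1]; push_cast; ring
    · rw [h0, h1]; push_cast; ring
  exact (sq_eq_sq₀ dist_nonneg hδ).1 hsq

/-- A point of `closure Ω` at positive distance from the frontier lies in `Ω`. [folklore] -/
theorem mem_of_mem_closure_of_infDist_pos {Ω : Set ℂ} {z : ℂ}
    (hz : z ∈ closure Ω) (hd : 0 < infDist z (frontier Ω)) : z ∈ Ω := by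
  rw [closure_eq_self_union_frontier] at hz
  rcases hz with hz | hz
  · exact hz
  · exact absurd (infDist_zero_of_mem hz) hd.ne'

set_option maxHeartbeats 400000 in
/-- **Interior convergence, uniformly.** In the setting of `abs_sub_le_near_frontier`, if
moreover `Ω` is open and `f` is harmonic on `Ω`, then `sup_{v ∈ Sₙ} |Fₙ v - f (δₙ v)| → 0`:
for every `ε > 0`, eventually `|Fₙ v - f (δₙ v)| ≤ ε` for all `v ∈ Sₙ`. (Consistency
`|Δ(f ∘ δₙ)| ≤ C δₙ⁴` on compacts of `Ω` + stability of the discrete Poisson problem in a box of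
radius `O(1/δₙ)` + the boundary estimate.) Kenyon 2000, proof of Lemma 17. [cite: Kenyon2000, Lemma 17] -/
theorem abs_sub_le_of_harmonicOnNhd {Ω : Set ℂ} (hΩo : IsOpen Ω) (hΩb : Bornology.IsBounded Ω)
    {r₀ : ℝ} (hr₀ : 0 < r₀)
    (hUEQ : ∀ ζ ∈ frontier Ω, ∃ s₁ s₂ : ℝ, (s₁ = 1 ∨ s₁ = -1) ∧ (s₂ = 1 ∨ s₂ = -1) ∧
      ∀ z : ℂ, s₁ * ζ.re < s₁ * z.re → s₂ * ζ.im < s₂ * z.im → dist z ζ < r₀ → z ∉ closure Ω)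
    {δ : ℕ → ℝ} (hδ : ∀ n, 0 < δ n) (hδ0 : Tendsto δ atTop (𝓝 0))
    {S : ℕ → Set (Site 2)} (hS : ∀ n v, v ∈ S n ↔ meshPoint (δ n) v ∈ closure Ω)
    {F : ℕ → Site 2 → ℝ} (hF : ∀ n, IsLatticeHarmonicOn (F n) (S n))
    {Φ : ℂ → ℝ} (hΦ : ∀ ζ ∈ frontier Ω, ContinuousAt Φ ζ)
    (hdata : ∀ ε > 0, ∀ᶠ n in atTop, ∀ w ∈ latticeOuterBoundary (S n),
      |F n w - Φ (meshPoint (δ n) w)| ≤ ε)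
    {f : ℂ → ℝ} (hf : ContinuousOn f (closure Ω)) (hfΦ : ∀ ζ ∈ frontier Ω, f ζ = Φ ζ)
    (hfh : InnerProductSpace.HarmonicOnNhd f Ω)
    {ε : ℝ} (hε : 0 < ε) :
    ∀ᶠ n in atTop, ∀ v ∈ S n, |F n v - f (meshPoint (δ n) v)| ≤ ε := by
  -- the boundary layer
  obtain ⟨ρ, hρ, hbdry⟩ := abs_sub_le_near_frontier hΩb hr₀ hUEQ hδ hδ0 hS hF hΦ hdata hf hfΦ
    (show (0 : ℝ) < ε / 2 by positivity)
  -- the compact `K ⊆ Ω` at distance `≥ ρ/2` from the frontier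
  set K : Set ℂ := closure Ω ∩ {z | ρ / 2 ≤ infDist z (frontier Ω)} with hK
  have hKcl : IsClosed K :=
    isClosed_closure.inter (isClosed_le continuous_const (continuous_infDist_pt _))
  have hKc : IsCompact K := hΩb.isCompact_closure.of_isClosed_subset hKcl inter_subset_left
  have hKΩ : K ⊆ Ω := fun z hz =>
    mem_of_mem_closure_of_infDist_pos hz.1 (lt_of_lt_of_le (by positivity) hz.2)
  -- consistency on `K`
  obtain ⟨C, δ₀, hC0, hδ₀, hcons⟩ :=
    exists_abs_latticeLaplacian_meshPoint_le_of_harmonicOnNhd hΩo hfh hKc hKΩ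
  -- a radius for `closure Ω`
  obtain ⟨Rad, hRad⟩ := (isBounded_iff_subset_closedBall (0 : ℂ)).1 hΩb.closure
  set Rm : ℝ := max Rad 1 with hRm
  have hRm1 : 1 ≤ Rm := le_max_right _ _
  have hsubRm : closure Ω ⊆ closedBall 0 Rm :=
    hRad.trans (closedBall_subset_closedBall (le_max_left _ _))
  -- eventually: small mesh
  have hpos : 0 < min (min δ₀ (ρ / 2)) 1 := by positivity
  have hev : ∀ᶠ n in atTop, δ n < min (min δ₀ (ρ / 2)) 1 ∧ C * (Rm + 1) ^ 2 * δ n ^ 2 ≤ ε / 2 := by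
    refine (hδ0.eventually (Iio_mem_nhds hpos)).and ?_
    have h1 : Tendsto (fun n => C * (Rm + 1) ^ 2 * δ n ^ 2) atTop (𝓝 (C * (Rm + 1) ^ 2 * 0 ^ 2)) :=
      (hδ0.pow 2).const_mul _
    rw [zero_pow two_ne_zero, mul_zero] at h1
    exact h1.eventually (Iic_mem_nhds (by positivity))
  filter_upwards [hbdry, hev] with n hbd hdn
  obtain ⟨hd1, hd2⟩ := hdn
  intro v hv
  set d : ℝ := δ n with hd
  have hd0 : 0 < d := hδ n
  have hdδ₀ : d ≤ δ₀ :=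
    (hd1.le.trans (min_le_left _ _)).trans (min_le_left _ _)
  have hdρ : d < ρ / 2 :=
    lt_of_lt_of_le hd1 ((min_le_left _ _).trans (min_le_right _ _))
  have hd1' : d ≤ 1 := hd1.le.trans (min_le_right _ _)
  have hvcl : meshPoint d v ∈ closure Ω := (hS n v).1 hv
  by_cases hvK : meshPoint d v ∈ K
  · -- interior: stability on `S' = {u ∈ Sₙ | δₙ u ∈ K}`
    set S' : Set (Site 2) := {u | u ∈ S n ∧ meshPoint d u ∈ K} with hS'
    have hS'fin : S'.Finite :=
      (meshVertices_finite (Ω := closure Ω) hΩb.closure hd0).subset fun u hu => (hS n u).1 hu.1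
    set e : Site 2 → ℝ := fun u => F n u - f (meshPoint d u) with he
    have hΔ : ∀ u ∈ S', |latticeLaplacian e u| ≤ C * d ^ 4 := by
      intro u hu
      have h1 : latticeLaplacian e u =
          latticeLaplacian (F n) u - latticeLaplacian (fun u => f (meshPoint d u)) u :=
        latticeLaplacian_sub _ _ _
      rw [h1, hF n u hu.1, zero_sub, abs_neg]
      exact hcons d hd0 hdδ₀ u hu.2
    have hB : ∀ w ∈ latticeOuterBoundary S', |e w| ≤ ε / 2 := by
      intro w hw
      obtain ⟨hwS', v', hv'S', k, rfl⟩ := hw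
      -- the neighbour `w` still lies in `Sₙ`
      have hwS : v' + cornerUnit k ∈ S n := by
        by_contra hwS
        have hwcl : meshPoint d (v' + cornerUnit k) ∉ closure Ω := fun h => hwS ((hS n _).2 h)
        obtain ⟨ζ, hζ, hζ1, -⟩ := exists_frontier_dist_le_of_closure hv'S'.2.1 hwcl
        rw [dist_meshPoint_add_cornerUnit_of_nonneg hd0.le] at hζ1
        have h2 : infDist (meshPoint d v') (frontier Ω) ≤ d := (infDist_le_dist_of_mem hζ).trans hζ1
        have h3 : ρ / 2 ≤ infDist (meshPoint d v') (frontier Ω) := hv'S'.2.2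
        linarith
      have hwK : meshPoint d (v' + cornerUnit k) ∉ K := fun h => hwS' ⟨hwS, h⟩
      have hwcl : meshPoint d (v' + cornerUnit k) ∈ closure Ω := (hS n _).1 hwS
      have hwdist : infDist (meshPoint d (v' + cornerUnit k)) (frontier Ω) < ρ := by
        have : ¬ ρ / 2 ≤ infDist (meshPoint d (v' + cornerUnit k)) (frontier Ω) :=
          fun h => hwK ⟨hwcl, h⟩
        linarith [lt_of_not_ge this]
      exact hbd _ hwS hwdist
    have hbox : ∀ w ∈ latticeOuterBoundary S',
        |((w 0 : ℤ) : ℝ) - (((0 : Site 2) 0 : ℤ) : ℝ)| ≤ Rm / d + 1 ∧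
        |((w 1 : ℤ) : ℝ) - (((0 : Site 2) 1 : ℤ) : ℝ)| ≤ Rm / d + 1 := by
      intro w hw
      obtain ⟨-, v', hv'S', k, rfl⟩ := hw
      have h1 : ‖meshPoint d v'‖ ≤ Rm := by
        have := hsubRm hv'S'.2.1
        rwa [mem_closedBall, dist_zero_right] at this
      have h2 : ‖meshPoint d (v' + cornerUnit k)‖ ≤ Rm + d := by
        have h3 := dist_meshPoint_add_cornerUnit_of_nonneg hd0.le v' k
        rw [dist_comm, dist_eq_norm] at h3
        have h4 : ‖meshPoint d (v' + cornerUnit k)‖ ≤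
            ‖meshPoint d (v' + cornerUnit k) - meshPoint d v'‖ + ‖meshPoint d v'‖ := by
          simpa [sub_add_cancel] using
            norm_add_le (meshPoint d (v' + cornerUnit k) - meshPoint d v') (meshPoint d v')
        rw [h3] at h4
        linarith
      have hz0 : (((0 : Site 2) 0 : ℤ) : ℝ) = 0 := by simp
      have hz1 : (((0 : Site 2) 1 : ℤ) : ℝ) = 0 := by simp
      rw [hz0, hz1, sub_zero, sub_zero]
      have hN : ∀ t : ℝ, |d * t| ≤ Rm + d → |t| ≤ Rm / d + 1 := by
        intro t ht
        rw [abs_mul, abs_of_pos hd0] at ht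
        rw [div_add_one hd0.ne', le_div_iff₀ hd0]
        linarith [mul_comm d |t|]
      constructor
      · refine hN _ ((le_trans ?_ h2))
        rw [← meshPoint_re]; exact abs_re_le_norm _
      · refine hN _ ((le_trans ?_ h2))
        rw [← meshPoint_im]; exact abs_im_le_norm _
    have key := abs_le_of_abs_latticeLaplacian_le hS'fin (by positivity) hΔ hB hbox ⟨hv, hvK⟩
    have hsmall : C * d ^ 4 * (Rm / d + 1) ^ 2 / 2 ≤ ε / 2 := by
      have e1 : d ^ 4 * (Rm / d + 1) ^ 2 = d ^ 2 * (Rm + d) ^ 2 := by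
        field_simp
      have e2 : (Rm + d) ^ 2 ≤ (Rm + 1) ^ 2 :=
        pow_le_pow_left₀ (by positivity) (by linarith) 2
      calc C * d ^ 4 * (Rm / d + 1) ^ 2 / 2 = C * (d ^ 2 * (Rm + d) ^ 2) / 2 := by
            rw [mul_assoc, e1]
        _ ≤ C * (d ^ 2 * (Rm + 1) ^ 2) / 2 := by gcongr
        _ = C * (Rm + 1) ^ 2 * d ^ 2 / 2 := by ring
        _ ≤ ε / 2 := by linarith
    have : |e v| ≤ ε := by linarith
    simpa only [he] using this
  · -- near the frontier
    have : infDist (meshPoint d v) (frontier Ω) < ρ / 2 := lt_of_not_ge fun h => hvK ⟨hvcl, h⟩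
    exact (hbd v hv (by linarith)).trans (by linarith)

end Literature.Probability.LatticeModels
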